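import Summits.BirchSwinnertonDyer.BirchSwinnertonDyer.Theorems.SignedBaseChangeAnticyclotomicEisensteinDivisibilitySpecializationHerbrand
import Literature.NumberTheory.EllipticCurves.IwasawaAlgebraProofs
import HarnessLib

/-!
# Sketch (idea «telescope», crux `EisensteinPrimes.BSDpOnCellC`, stmt-BirchSwinnertonDyer-19034) —
# First lemma: the Euler-characteristic ideal of a two-variable complex specialises EXACTLY to a fibre,
# although none of its cohomology modules need do so (the control errors telescope).

Setting (pure commutative algebra, the currency of the tree's `Module.charIdeal`): `A` a factorial
Noetherian domain with `A⟦X⟧` factorial (e.g. `A = Λ_ac = 𝒪⟦T⟧`, `A⟦X⟧ = Λ₂ = 𝒪⟦T⟧⟦X⟧`, `X` = Hida's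
disc-chart weight variable centred at the `p`-new point). `H₁, H₂, H₃` are the cohomology modules of a perfect
two-variable (Selmer) complex `C₂` with `H₀ = H₄ = 0`, finitely generated torsion over `A⟦X⟧` away from `(X)`;
`G₁, G₂, G₃` are the cohomology modules of the fibre complex `C₂ ⊗ᴸ A⟦X⟧/(X)`. The derived base change
gives the short exact sequences `0 → Hᵢ/XHᵢ → Gᵢ → Hᵢ₊₁[X] → 0` (`i = 1, 2`), `H₃/XH₃ ≅ G₃`, and `H₁[X] = 0`
(⟸ `G₀ = 0`). CONCLUSION: `char_A(G₂)·char(H₁)(0)·char(H₃)(0) = char_A(G₁)·char_A(G₃)·char(H₂)(0)`, i.e.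
the alternating product `χ = char(H₂)/(char(H₁)·char(H₃))` satisfies `χ(C₂)(0) = χ(C₂ ⊗ᴸ A)` exactly.
Ingredients (all tree theorems): the Herbrand form of specialisation
`PowerSeriesSpecialization.charIdeal_quotSMulTop_eq_mul` (`ch_A(N/XN) = ch_A(N[X])·ch(N)(0)`) three times and
multiplicativity `Module.charIdeal_eq_mul_of_exact` twice; the `Hᵢ₊₁[X]` terms cancel in pairs.
Nothing about elliptic curves or Selmer groups is asserted here. [folklore: Euler–Poincaré characteristics of
perfect complexes commute with base change — Nekovář, Selmer Complexes (2006) §4–§7; Burns–Venjakob descent]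
-/

set_option linter.dupNamespace false
set_option autoImplicit false

namespace Summit.BirchSwinnertonDyer.BirchSwinnertonDyer.Cruxes.BSDpOnCellC.Telescope

open Literature.NumberTheory.EllipticCurves Literature.NumberTheory.EllipticCurves.Module
open Summit.BirchSwinnertonDyer.BirchSwinnertonDyer.Theorems.SignedBaseChangeAcDivSpecialization
open PowerSeries

variable {A : Type*} [CommRing A] [IsDomain A] [IsNoetherianRing A] [UniqueFactorizationMonoid A]
  [UniqueFactorizationMonoid (PowerSeries A)]

/-- **Telescoping of control errors in the Euler-characteristic ideal (first lemma of «telescope»).**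
For the cohomology `H₁, H₂, H₃` (f.g. `A⟦X⟧`-modules killed by power series with nonzero constant term)
of a two-variable complex and the cohomology `G₁, G₂, G₃` (f.g. torsion `A`-modules) of its fibre at
`X = 0`, linked by the base-change short exact sequences `0 → Hᵢ/X → Gᵢ → Hᵢ₊₁[X] → 0` (`i = 1, 2`),
`H₃/X ≃ G₃`, with `H₁[X] = 0`: the alternating products of characteristic ideals agree after
specialisation, `char(G₂)·char(H₁)(0)·char(H₃)(0) = char(G₁)·char(G₃)·char(H₂)(0)` — the
non-interpolable torsion terms `H₂[X]`, `H₃[X]` cancel. [folklore] -/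
theorem charIdeal_eulerChar_specialises
    (H₁ H₂ H₃ : Type*) [AddCommGroup H₁] [AddCommGroup H₂] [AddCommGroup H₃]
    [Module (PowerSeries A) H₁] [Module (PowerSeries A) H₂] [Module (PowerSeries A) H₃]
    [Module.Finite (PowerSeries A) H₁] [Module.Finite (PowerSeries A) H₂]
    [Module.Finite (PowerSeries A) H₃]
    [Module A H₁] [Module A H₂] [Module A H₃]
    [IsScalarTower A (PowerSeries A) H₁] [IsScalarTower A (PowerSeries A) H₂]
    [IsScalarTower A (PowerSeries A) H₃]
    (G₁ G₂ G₃ : Type*) [AddCommGroup G₁] [AddCommGroup G₂] [AddCommGroup G₃]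
    [Module A G₁] [Module A G₂] [Module A G₃]
    [Module.Finite A G₁] [Module.Finite A G₂] [Module.Finite A G₃]
    (hH₁ : ∃ s : PowerSeries A, constantCoeff s ≠ 0 ∧ ∀ m : H₁, s • m = 0)
    (hH₂ : ∃ s : PowerSeries A, constantCoeff s ≠ 0 ∧ ∀ m : H₂, s • m = 0)
    (hH₃ : ∃ s : PowerSeries A, constantCoeff s ≠ 0 ∧ ∀ m : H₃, s • m = 0)
    (hG₁ : Module.IsTorsion A G₁) (hG₂ : Module.IsTorsion A G₂)
    -- base change `i = 1`: `0 → H₁/X → G₁ → H₂[X] → 0`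
    (f₁ : QuotSMulTop (X : PowerSeries A) H₁ →ₗ[A] G₁)
    (g₁ : G₁ →ₗ[A] Submodule.torsionBy (PowerSeries A) H₂ (X : PowerSeries A))
    (hf₁ : Function.Injective f₁) (hg₁ : Function.Surjective g₁) (h₁ : Function.Exact f₁ g₁)
    -- base change `i = 2`: `0 → H₂/X → G₂ → H₃[X] → 0`
    (f₂ : QuotSMulTop (X : PowerSeries A) H₂ →ₗ[A] G₂)
    (g₂ : G₂ →ₗ[A] Submodule.torsionBy (PowerSeries A) H₃ (X : PowerSeries A))
    (hf₂ : Function.Injective f₂) (hg₂ : Function.Surjective g₂) (h₂ : Function.Exact f₂ g₂)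
    -- base change `i = 3` (`H₄ = 0`): `H₃/X ≃ G₃`
    (e₃ : QuotSMulTop (X : PowerSeries A) H₃ ≃ₗ[A] G₃)
    -- `H₀` of the fibre vanishes: `H₁[X] = 0`
    (h0 : Submodule.torsionBy (PowerSeries A) H₁ (X : PowerSeries A) = ⊥) :
    charIdeal A G₂ * (charIdeal (PowerSeries A) H₁).map (constantCoeff (R := A)) *
        (charIdeal (PowerSeries A) H₃).map (constantCoeff (R := A)) =
      charIdeal A G₁ * charIdeal A G₃ *
        (charIdeal (PowerSeries A) H₂).map (constantCoeff (R := A)) := by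
  -- multiplicativity along the two base-change sequences, invariance along `e₃`
  have e1 := charIdeal_eq_mul_of_exact hG₁ f₁ g₁ hf₁ hg₁ h₁
  have e2 := charIdeal_eq_mul_of_exact hG₂ f₂ g₂ hf₂ hg₂ h₂
  have e3 : charIdeal A G₃ = charIdeal A (QuotSMulTop (X : PowerSeries A) H₃) :=
    (LocalLength.charIdeal_eq_of_linearEquiv e₃).symm
  -- Herbrand form of specialisation for each `Hᵢ`
  have hb1 := PowerSeriesSpecialization.charIdeal_quotSMulTop_eq_mul (A := A) H₁ hH₁
  have hb2 := PowerSeriesSpecialization.charIdeal_quotSMulTop_eq_mul (A := A) H₂ hH₂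
  have hb3 := PowerSeriesSpecialization.charIdeal_quotSMulTop_eq_mul (A := A) H₃ hH₃
  -- `H₁[X] = 0`
  haveI : Subsingleton (Submodule.torsionBy (PowerSeries A) H₁ (X : PowerSeries A)) := by
    rw [h0]; infer_instance
  have ht1 : charIdeal A (Submodule.torsionBy (PowerSeries A) H₁ (X : PowerSeries A)) = 1 :=
    LocalLength.charIdeal_eq_one_of_subsingleton
  rw [e1, e2, e3, hb1, hb2, hb3, ht1]
  ring

/-- **Corollary (the shape used by the line): two-sided transfer of a rational identity.** In the
setting of `charIdeal_eulerChar_specialises`, if moreover `G₁` and `G₃` have trivial characteristic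
ideal (pseudo-null fibre terms — the case of finite `H⁰`-type error terms) then
`char(G₂)·char(H₁)(0)·char(H₃)(0) = char(H₂)(0)`: the fibre's `H₂` is read off the two-variable
alternating product with NO control term. [folklore] -/
theorem charIdeal_fibre_eq_of_pseudoNull
    (H₁ H₂ H₃ : Type*) [AddCommGroup H₁] [AddCommGroup H₂] [AddCommGroup H₃]
    [Module (PowerSeries A) H₁] [Module (PowerSeries A) H₂] [Module (PowerSeries A) H₃]
    [Module.Finite (PowerSeries A) H₁] [Module.Finite (PowerSeries A) H₂]
    [Module.Finite (PowerSeries A) H₃]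
    [Module A H₁] [Module A H₂] [Module A H₃]
    [IsScalarTower A (PowerSeries A) H₁] [IsScalarTower A (PowerSeries A) H₂]
    [IsScalarTower A (PowerSeries A) H₃]
    (G₁ G₂ G₃ : Type*) [AddCommGroup G₁] [AddCommGroup G₂] [AddCommGroup G₃]
    [Module A G₁] [Module A G₂] [Module A G₃]
    [Module.Finite A G₁] [Module.Finite A G₂] [Module.Finite A G₃]
    (hH₁ : ∃ s : PowerSeries A, constantCoeff s ≠ 0 ∧ ∀ m : H₁, s • m = 0)
    (hH₂ : ∃ s : PowerSeries A, constantCoeff s ≠ 0 ∧ ∀ m : H₂, s • m = 0)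
    (hH₃ : ∃ s : PowerSeries A, constantCoeff s ≠ 0 ∧ ∀ m : H₃, s • m = 0)
    (hG₁ : Module.IsTorsion A G₁) (hG₂ : Module.IsTorsion A G₂)
    (f₁ : QuotSMulTop (X : PowerSeries A) H₁ →ₗ[A] G₁)
    (g₁ : G₁ →ₗ[A] Submodule.torsionBy (PowerSeries A) H₂ (X : PowerSeries A))
    (hf₁ : Function.Injective f₁) (hg₁ : Function.Surjective g₁) (h₁ : Function.Exact f₁ g₁)
    (f₂ : QuotSMulTop (X : PowerSeries A) H₂ →ₗ[A] G₂)
    (g₂ : G₂ →ₗ[A] Submodule.torsionBy (PowerSeries A) H₃ (X : PowerSeries A))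
    (hf₂ : Function.Injective f₂) (hg₂ : Function.Surjective g₂) (h₂ : Function.Exact f₂ g₂)
    (e₃ : QuotSMulTop (X : PowerSeries A) H₃ ≃ₗ[A] G₃)
    (h0 : Submodule.torsionBy (PowerSeries A) H₁ (X : PowerSeries A) = ⊥)
    (hG₁1 : charIdeal A G₁ = 1) (hG₃1 : charIdeal A G₃ = 1) :
    charIdeal A G₂ * (charIdeal (PowerSeries A) H₁).map (constantCoeff (R := A)) *
        (charIdeal (PowerSeries A) H₃).map (constantCoeff (R := A)) =
      (charIdeal (PowerSeries A) H₂).map (constantCoeff (R := A)) := by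
  have h := charIdeal_eulerChar_specialises H₁ H₂ H₃ G₁ G₂ G₃ hH₁ hH₂ hH₃ hG₁ hG₂ f₁ g₁ hf₁ hg₁ h₁
    f₂ g₂ hf₂ hg₂ h₂ e₃ h0
  rw [hG₁1, hG₃1, one_mul, one_mul] at h
  exact h

end Summit.BirchSwinnertonDyer.BirchSwinnertonDyer.Cruxes.BSDpOnCellC.Telescope
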